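import Summits.QuantumFields.BalabanUV.Beta.GAN24.GaugeReadChargeComb

/-!
# `BalabanUV.Beta.GAN24.GaugeReadChargeTotals` — binder row G-an2-4 ∕ (CONV-C), CT-W «WC-TL», (Q-R) «QR-LL», the (S) row after RULING R-gan24p1-g28-1 («(INV)_{α+γ} :=
# (INV-X-geo) ∘ (W-γ) in the exit ∕ flat-mode currency»), piece (γ): **THE (γ) CHARGE AGAINST SLOT-CONSTANT TABLE CHARGES IS THE TOTAL READ WEIGHTS TIMES THE TABLE
# CHARGES, AND THE TOTAL READ WEIGHTS ARE A FINITE BOX SUM OF COLUMN-SUM DIFFERENCES OF THE RESPONSE KERNEL** — the (γ) side of the plain sub-row (T-F) of (W-γ)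
# (road-P2 g39's R2 (b) ∕ INTENT 2′ `WardResidualRotatedVertexTotals` is the (α⁺) side; E26b: `W^γ_κ + W^{α⁺}_κ = 0` to 2.8e-14, NOT claimed here)
# (G-an2-4 formalisation swarm, unit `b2b-balaban-gan24-formalise-leaf-06`, gen 45; INTENT 5 — WANTED by p2 g39 W-1 (B)).

NOT IN PRINT; OUR BOOKKEEPING ([folklore]: `tsum_mul_right`; this lineage's `GaugeReadCharge.tsum_read_eq_read_colProfile` (the weight mass is the read of the COLUMN-SUMMED kernel);
leaf-03's finite box form `Lin4LegDivergence.tsum_mul_gaugeWt_eq_boxSum`; one coarse Fubini on `GaugeReadChargeMass.summable_coarseGauss`; INTENT 4 `GaugeReadChargeComb` §1 for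
the literal).  HONEST FRAMING (cell contract, verbatim): «discharging `BetaPertH` makes Bałaban's UV stability UNCONDITIONAL — a real constructive-QFT result; it is NOT the
continuum limit and NOT the Clay problem.»  HONEST DEPENDENCY (verbatim): «continuum YM on T⁴ ⇐ BetaPertH ∧ nine spine estimates (0/9 proved); BetaPertH ⇐ (D1) ∧ (D4) ∧ CAP+tail;
G-an2-4 gates asym, D1 and NE2/3/4.»  No cited fact, no `def`, no `def … : Prop`, 0 sorry.

SETTING of `GaugeReadChargeProfile` (`1 ≤ N`, response kernel `A` bi-localised at `(p, q)` ∕ slot family `A ν y′`, `LocStencil S Cs δ`, `VertexFamily M N CM δ`, label `y`, channel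
`(a,b)`, weight `ω`).  SLOT-CONSTANT TABLE CHARGES: `Z_ω(S κ u) = ζS κ` for every `u`, `Z_ω(M ρ w) = ζM ρ` for every `w` (displayed; for the plain weight `ω ≡ 1` and the
literal tables this is the `u`-independence of the plain double-leg charges — block-periodicity is road-P2's `pairCharge_SpureRecAt_block` ∕ `weightedCharge_M1At_const`, the
within-block constancy is the one extra table fact, E26g-exact on SDF-1, NOT typed here).
* §1 **`hasSum_weighted_gaugeSup_of_slotConst`**: the (γ) ω-charge of the slot is `Σ_κ (Σ'_u w_κ(u))·ζS κ + Σ_ρ (Σ'_w w′_ρ(w))·ζM ρ` — TOTAL READ WEIGHTS × table charges.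
* §2 THE TOTAL READ WEIGHTS IN FINITE FORM: `tsum_fineWeight_eq_boxSum` — `Σ'_u w_κ(u) = Σ_{v ∈ box} Σ_κ₂ (C_κ κ₂ (N•y + v − e_κ₂) − C_κ κ₂ (N•y + v))`, `C_κ κ₂ x₂ := Σ'_u A u x₂ (inl κ)(inl κ₂)`
  (the COLUMN SUMS of the response kernel); `tsum_coarseRead_eq_read_colSum`, `tsum_coarseWeight_eq_boxSum` — the coarse twin with `C′_ρ κ₂ x₂ := Σ'_w A (N•w) x₂ (inr ρ)(inl κ₂)`.
* §3 **`hasSum_weighted_gaugeSup_eq_totals`**: §1 ∘ §2 — the (γ) ω-charge per slot as a FINITE box sum of column-sum differences times the table charges.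
* §4 the LITERAL comb letter: **`hasSum_comb_gaugeCharge_eq_totals`** (`A_j(ν,y′) = G_j ∘ dM G_j Lc S_j M1_j ν y′`, INTENT 4's family) — the (γ) half of (T-F) in closed finite
  form; road-P2 g39's `WardResidualRotatedVertexTotals.totalWeightEnd_eq` is the (α⁺) half; (T-F) itself («they are opposite») is NOT claimed.
Asserts NO value of any column sum or table charge, NOTHING of (W-γ) ∕ (T-F) ∕ (INV); discharges NOTHING of (S) ∕ (Q-R) ∕ (LT) ∕ (Q-L) ∕ (C) ∕ «T2Shape» ∕ «T2Drift» ∕ (hW, hWall);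
NEVER «G-an2-4 closed» as (CONV-C); NOT D1, NOT BetaPertH, NOT continuum, NOT Clay.  2026-08-22; no existing file touched.
-/

noncomputable section

open Finset
open scoped BigOperators
open Literature.MathematicalPhysics.QuantumFieldTheory
open Literature.MathematicalPhysics.QuantumFieldTheory.Balaban1983to89
open Literature.MathematicalPhysics.QuantumFieldTheory.Balaban1983to89.Beta
open B12Sec2to5 (l1 l1_nonneg)
open B6BondElimination (unitVec)
open ExpKernelCalculus (Site MKer BiLoc Decays VertexFamily Zl comp summable_exp_shift')
open AffineAveraging (box toSite)
open OneStepResolventKernel (Fib wsum LocStencil)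
open OneStepKernelFamily (KInvStep)
open SecondOrderResponse (dM)
open InterLevelTransport (cwsum)
open Summit.QuantumFields.BalabanUV.Beta.AxialDressingRooted (coDressKBmAt)
open Summit.QuantumFields.BalabanUV.Beta.SpineRooted (SpureRecAt M1At)
open Summit.QuantumFields.BalabanUV.Beta.KernelWardRelative (gaugeWt)
open Summit.QuantumFields.BalabanUV.Beta.KernelWardResidual (abs_gaugeWt_le_one)
open Summit.QuantumFields.BalabanUV.Beta.GAN24.Lin4LegDivergence (tsum_mul_gaugeWt_eq_boxSum)
open Summit.QuantumFields.BalabanUV.Beta.GAN24.GaugeReadLabelSums (abs_read_term_le)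
open Summit.QuantumFields.BalabanUV.Beta.GAN24.GaugeReadCharge (tsum_read_eq_read_colProfile)
open Summit.QuantumFields.BalabanUV.Beta.GAN24.GaugeReadChargeProfile (hasSum_weighted_gaugeSup)
open Summit.QuantumFields.BalabanUV.Beta.GAN24.GaugeReadChargeMass (summable_coarseGauss)
open Summit.QuantumFields.BalabanUV.Beta.GAN24.GaugeReadChargeComb (exists_vertexFamily_combResponse)

namespace Summit.QuantumFields.BalabanUV.Beta.GAN24.GaugeReadChargeTotals

variable {d : ℕ}

/-! ## §1 Slot-constant table charges: the (γ) charge is total read weights × table charges -/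

/-- NOT IN PRINT; OUR BOOKKEEPING.  **THE (γ) ω-CHARGE AGAINST SLOT-CONSTANT TABLE CHARGES** (`A` bi-localised at `(p,q)`, rate `δ > 0`; `|g| ≤ 1`; `LocStencil S Cs δ`,
`VertexFamily M N CM δ`, `1 ≤ N`; `|ω| ≤ B`; `Z_ω(S κ u) = ζS κ` for every `u`, `Z_ω(M ρ w) = ζM ρ` for every `w`): the ω-charge of the response piece `𝒢[A](g)` is
`Σ_κ (Σ'_u w_κ(u))·ζS κ + Σ_ρ (Σ'_y w′_ρ(y))·ζM ρ` — only the TOTAL read weights enter (`GaugeReadChargeProfile.hasSum_weighted_gaugeSup` + `tsum_mul_right`). -/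
theorem hasSum_weighted_gaugeSup_of_slotConst {A : MKer (d + 1) (Fib d)} {p q : Site (d + 1)} {C δ : ℝ} (hA : BiLoc A p q C δ) (hδ : 0 < δ)
    {g : Fin (d + 1) → Site (d + 1) → ℝ} (hg : ∀ κ x, |g κ x| ≤ 1) {N : ℕ} [NeZero N] (hN : 1 ≤ N)
    {S : Fin (d + 1) → Site (d + 1) → MKer (d + 1) (Fib d)} {Cs : ℝ} (hS : LocStencil S Cs δ)
    {M : Fin (d + 1) → Site (d + 1) → MKer (d + 1) (Fib d)} {CM : ℝ} (hM : VertexFamily M N CM δ) (a b : Fib d)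
    {ω : Site (d + 1) × Site (d + 1) → ℝ} {B : ℝ} (hω : ∀ xz, |ω xz| ≤ B) {ζS ζM : Fin (d + 1) → ℝ}
    (hζS : ∀ κ u, ∑' xz : Site (d + 1) × Site (d + 1), ω xz * S κ u xz.1 xz.2 a b = ζS κ)
    (hζM : ∀ ρ w, ∑' xz : Site (d + 1) × Site (d + 1), ω xz * M ρ w xz.1 xz.2 a b = ζM ρ) :
    HasSum (fun xz : Site (d + 1) × Site (d + 1) => ω xz *
        (∑ κ, wsum (fun u => ∑' x₂, ∑ κ₂, A u x₂ (Sum.inl κ) (Sum.inl κ₂) * g κ₂ x₂) (S κ)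
          + ∑ ρ, cwsum N (fun y => ∑' x₂, ∑ κ₂, A ((N : ℤ) • y) x₂ (Sum.inr ρ) (Sum.inl κ₂) * g κ₂ x₂) (M ρ)) xz.1 xz.2 a b)
      (∑ κ, (∑' u, ∑' x₂, ∑ κ₂, A u x₂ (Sum.inl κ) (Sum.inl κ₂) * g κ₂ x₂) * ζS κ
        + ∑ ρ, (∑' y, ∑' x₂, ∑ κ₂, A ((N : ℤ) • y) x₂ (Sum.inr ρ) (Sum.inl κ₂) * g κ₂ x₂) * ζM ρ) := by
  have h := hasSum_weighted_gaugeSup hA hδ hg hN hS hM a b hω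
  simp only [hζS, hζM, tsum_mul_right] at h
  exact h

/-! ## §2 The total read weights in finite form: box sums of column-sum differences -/

/-- NOT IN PRINT; OUR BOOKKEEPING.  **THE TOTAL FINE READ WEIGHT IS A FINITE BOX SUM OF COLUMN-SUM DIFFERENCES**: for `A` bi-localised at `(p,q)` (rate `δ > 0`), `1 ≤ N`, label `y`,
row `a`: `Σ'_u Σ'_{x₂} Σ_κ₂ A u x₂ a (inl κ₂)·gaugeWt N y κ₂ x₂ = Σ_{v ∈ box} Σ_κ₂ (C (N•y + v − e_κ₂) − C (N•y + v))`, `C x₂ := Σ'_u A u x₂ a (inl κ₂)` — this lineage's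
`tsum_read_eq_read_colProfile` (weight mass = read of the column sums) followed by leaf-03's `tsum_mul_gaugeWt_eq_boxSum` (the read against `ĝ_y` is a finite box sum). -/
theorem tsum_fineWeight_eq_boxSum {A : MKer (d + 1) (Fib d)} {p q : Site (d + 1)} {C δ : ℝ} (hA : BiLoc A p q C δ) (hδ : 0 < δ)
    {N : ℕ} (hN : 1 ≤ N) (y : Site (d + 1)) (a : Fib d) :
    ∑' u, (∑' x₂, ∑ κ₂, A u x₂ a (Sum.inl κ₂) * gaugeWt N y κ₂ x₂)
      = ∑ v ∈ box (d + 1) N, ∑ κ₂, ((∑' u, A u ((N : ℤ) • y + toSite v - unitVec κ₂) a (Sum.inl κ₂))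
          - ∑' u, A u ((N : ℤ) • y + toSite v) a (Sum.inl κ₂)) := by
  rw [tsum_read_eq_read_colProfile hA hδ (fun κ x => abs_gaugeWt_le_one N y κ x) a]
  exact tsum_mul_gaugeWt_eq_boxSum hN (fun κ₂ x₂ => ∑' u, A u x₂ a (Sum.inl κ₂)) y

/-- [folklore] **THE COARSE WEIGHT MASS IS THE READ OF THE COARSE COLUMN SUMS** (the coarse twin of `tsum_read_eq_read_colProfile`): for `A` bi-localised at `(p,q)`, `1 ≤ N`,
`|g| ≤ 1`: `Σ'_w (Σ'_{x₂} Σ_κ₂ A (N•w) x₂ a (inl κ₂)·g κ₂ x₂) = Σ'_{x₂} Σ_κ₂ (Σ'_w A (N•w) x₂ a (inl κ₂))·g κ₂ x₂` (Fubini on the coarse Gaussian × the fine one). -/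
theorem tsum_coarseRead_eq_read_colSum {A : MKer (d + 1) (Fib d)} {p q : Site (d + 1)} {C δ : ℝ} (hA : BiLoc A p q C δ) (hδ : 0 < δ)
    {N : ℕ} (hN : 1 ≤ N) {g : Fin (d + 1) → Site (d + 1) → ℝ} (hg : ∀ κ x, |g κ x| ≤ 1) (a : Fib d) :
    ∑' w, (∑' x₂, ∑ κ₂, A ((N : ℤ) • w) x₂ a (Sum.inl κ₂) * g κ₂ x₂)
      = ∑' x₂, ∑ κ₂, (∑' w, A ((N : ℤ) • w) x₂ a (Sum.inl κ₂)) * g κ₂ x₂ := by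
  -- the product majorant `(d+1)·C·e^{−δ‖N•w − p‖₁}·e^{−δ‖x₂ − q‖₁}` is summable on `Site × Site`
  have h1 : Summable fun w : Site (d + 1) => Real.exp (-δ * l1 ((N : ℤ) • w - p)) := summable_coarseGauss hN hδ p
  have h2 : Summable fun x : Site (d + 1) => Real.exp (-δ * l1 (x - q)) := summable_exp_shift' hδ q
  have hprod : Summable fun wx : Site (d + 1) × Site (d + 1) =>
      ((d + 1 : ℕ) * C) * (Real.exp (-δ * l1 ((N : ℤ) • wx.1 - p)) * Real.exp (-δ * l1 (wx.2 - q))) :=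
    (h1.mul_of_nonneg h2 (fun _ => (Real.exp_pos _).le) (fun _ => (Real.exp_pos _).le)).mul_left _
  have hs : Summable (Function.uncurry fun (w : Site (d + 1)) (x₂ : Site (d + 1)) => ∑ κ₂, A ((N : ℤ) • w) x₂ a (Sum.inl κ₂) * g κ₂ x₂) := by
    refine Summable.of_norm_bounded hprod (fun wx => ?_)
    rw [Real.norm_eq_abs]
    have h := abs_read_term_le hA hg ((N : ℤ) • wx.1) wx.2 a
    calc |∑ κ₂, A ((N : ℤ) • wx.1) wx.2 a (Sum.inl κ₂) * g κ₂ wx.2|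
        ≤ ((d + 1 : ℕ) * C * Real.exp (-δ * l1 ((N : ℤ) • wx.1 - p))) * Real.exp (-δ * l1 (wx.2 - q)) := h
      _ = ((d + 1 : ℕ) * C) * (Real.exp (-δ * l1 ((N : ℤ) • wx.1 - p)) * Real.exp (-δ * l1 (wx.2 - q))) := by ring
  rw [← hs.tsum_comm]
  refine tsum_congr fun x₂ => ?_
  -- each coarse column `w ↦ A (N•w) x₂ a (inl κ₂)·g κ₂ x₂` is summable
  have hcol : ∀ κ₂ : Fin (d + 1), Summable fun w : Site (d + 1) => A ((N : ℤ) • w) x₂ a (Sum.inl κ₂) * g κ₂ x₂ := fun κ₂ => by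
    refine Summable.of_norm_bounded ((h1.mul_left (C * Real.exp (-δ * l1 (x₂ - q)))).mul_right |g κ₂ x₂|) (fun w => ?_)
    rw [Real.norm_eq_abs, abs_mul]
    refine mul_le_mul_of_nonneg_right ?_ (abs_nonneg _)
    have h := hA ((N : ℤ) • w) x₂ a (Sum.inl κ₂)
    calc |A ((N : ℤ) • w) x₂ a (Sum.inl κ₂)| ≤ C * Real.exp (-δ * (l1 ((N : ℤ) • w - p) + l1 (x₂ - q))) := h
      _ = C * Real.exp (-δ * l1 (x₂ - q)) * Real.exp (-δ * l1 ((N : ℤ) • w - p)) := by rw [mul_add, Real.exp_add]; ring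
  rw [Summable.tsum_finsetSum (fun κ₂ _ => hcol κ₂)]
  exact Finset.sum_congr rfl fun κ₂ _ => by rw [tsum_mul_right]

/-- NOT IN PRINT; OUR BOOKKEEPING.  **THE TOTAL COARSE READ WEIGHT IS A FINITE BOX SUM OF COARSE-COLUMN-SUM DIFFERENCES**:
`Σ'_w Σ'_{x₂} Σ_κ₂ A (N•w) x₂ a (inl κ₂)·gaugeWt N y κ₂ x₂ = Σ_{v ∈ box} Σ_κ₂ (C′ (N•y + v − e_κ₂) − C′ (N•y + v))`, `C′ x₂ := Σ'_w A (N•w) x₂ a (inl κ₂)`. -/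
theorem tsum_coarseWeight_eq_boxSum {A : MKer (d + 1) (Fib d)} {p q : Site (d + 1)} {C δ : ℝ} (hA : BiLoc A p q C δ) (hδ : 0 < δ)
    {N : ℕ} (hN : 1 ≤ N) (y : Site (d + 1)) (a : Fib d) :
    ∑' w, (∑' x₂, ∑ κ₂, A ((N : ℤ) • w) x₂ a (Sum.inl κ₂) * gaugeWt N y κ₂ x₂)
      = ∑ v ∈ box (d + 1) N, ∑ κ₂, ((∑' w, A ((N : ℤ) • w) ((N : ℤ) • y + toSite v - unitVec κ₂) a (Sum.inl κ₂))
          - ∑' w, A ((N : ℤ) • w) ((N : ℤ) • y + toSite v) a (Sum.inl κ₂)) := by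
  rw [tsum_coarseRead_eq_read_colSum hA hδ hN (fun κ x => abs_gaugeWt_le_one N y κ x) a]
  exact tsum_mul_gaugeWt_eq_boxSum hN (fun κ₂ x₂ => ∑' w, A ((N : ℤ) • w) x₂ a (Sum.inl κ₂)) y

/-! ## §3 The (γ) ω-charge per slot as finite totals -/

/-- NOT IN PRINT; OUR BOOKKEEPING.  **THE (γ) ω-CHARGE AGAINST SLOT-CONSTANT TABLE CHARGES, IN FINITE FORM**: in the setting of §1 with the label-`y` gauge weight,
the ω-charge of `𝒢[A](ĝ_y)` is `Σ_κ [Σ_{v∈box} Σ_κ₂ (C_κ κ₂ (N•y+v−e_κ₂) − C_κ κ₂ (N•y+v))]·ζS κ + Σ_ρ [Σ_{v∈box} Σ_κ₂ (C′_ρ κ₂ (N•y+v−e_κ₂) − C′_ρ κ₂ (N•y+v))]·ζM ρ` with the column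
sums `C_κ κ₂ x₂ = Σ'_u A u x₂ (inl κ)(inl κ₂)`, `C′_ρ κ₂ x₂ = Σ'_w A (N•w) x₂ (inr ρ)(inl κ₂)` — the TOTAL READ WEIGHTS of road-P2 g39's R2 (b) («`Σ_u r(e)_{(κ,u)}`»), (γ) side, as a
finite closed form.  (T-F) («= minus the (α⁺) totals», E26b-exact) is NOT claimed. -/
theorem hasSum_weighted_gaugeSup_eq_totals {A : MKer (d + 1) (Fib d)} {p q : Site (d + 1)} {C δ : ℝ} (hA : BiLoc A p q C δ) (hδ : 0 < δ)
    {N : ℕ} [NeZero N] (hN : 1 ≤ N) (y : Site (d + 1))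
    {S : Fin (d + 1) → Site (d + 1) → MKer (d + 1) (Fib d)} {Cs : ℝ} (hS : LocStencil S Cs δ)
    {M : Fin (d + 1) → Site (d + 1) → MKer (d + 1) (Fib d)} {CM : ℝ} (hM : VertexFamily M N CM δ) (a b : Fib d)
    {ω : Site (d + 1) × Site (d + 1) → ℝ} {B : ℝ} (hω : ∀ xz, |ω xz| ≤ B) {ζS ζM : Fin (d + 1) → ℝ}
    (hζS : ∀ κ u, ∑' xz : Site (d + 1) × Site (d + 1), ω xz * S κ u xz.1 xz.2 a b = ζS κ)
    (hζM : ∀ ρ w, ∑' xz : Site (d + 1) × Site (d + 1), ω xz * M ρ w xz.1 xz.2 a b = ζM ρ) :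
    HasSum (fun xz : Site (d + 1) × Site (d + 1) => ω xz *
        (∑ κ, wsum (fun u => ∑' x₂, ∑ κ₂, A u x₂ (Sum.inl κ) (Sum.inl κ₂) * gaugeWt N y κ₂ x₂) (S κ)
          + ∑ ρ, cwsum N (fun w => ∑' x₂, ∑ κ₂, A ((N : ℤ) • w) x₂ (Sum.inr ρ) (Sum.inl κ₂) * gaugeWt N y κ₂ x₂) (M ρ)) xz.1 xz.2 a b)
      (∑ κ, (∑ v ∈ box (d + 1) N, ∑ κ₂, ((∑' u, A u ((N : ℤ) • y + toSite v - unitVec κ₂) (Sum.inl κ) (Sum.inl κ₂))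
            - ∑' u, A u ((N : ℤ) • y + toSite v) (Sum.inl κ) (Sum.inl κ₂))) * ζS κ
        + ∑ ρ, (∑ v ∈ box (d + 1) N, ∑ κ₂, ((∑' w, A ((N : ℤ) • w) ((N : ℤ) • y + toSite v - unitVec κ₂) (Sum.inr ρ) (Sum.inl κ₂))
            - ∑' w, A ((N : ℤ) • w) ((N : ℤ) • y + toSite v) (Sum.inr ρ) (Sum.inl κ₂))) * ζM ρ) := by
  have h := hasSum_weighted_gaugeSup_of_slotConst hA hδ (fun κ x => abs_gaugeWt_le_one N y κ x) hN hS hM a b hω hζS hζM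
  have eF : ∀ κ : Fin (d + 1), (∑' u, ∑' x₂, ∑ κ₂, A u x₂ (Sum.inl κ) (Sum.inl κ₂) * gaugeWt N y κ₂ x₂)
      = ∑ v ∈ box (d + 1) N, ∑ κ₂, ((∑' u, A u ((N : ℤ) • y + toSite v - unitVec κ₂) (Sum.inl κ) (Sum.inl κ₂))
          - ∑' u, A u ((N : ℤ) • y + toSite v) (Sum.inl κ) (Sum.inl κ₂)) := fun κ => tsum_fineWeight_eq_boxSum hA hδ hN y (Sum.inl κ)
  have eC : ∀ ρ : Fin (d + 1), (∑' w, ∑' x₂, ∑ κ₂, A ((N : ℤ) • w) x₂ (Sum.inr ρ) (Sum.inl κ₂) * gaugeWt N y κ₂ x₂)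
      = ∑ v ∈ box (d + 1) N, ∑ κ₂, ((∑' w, A ((N : ℤ) • w) ((N : ℤ) • y + toSite v - unitVec κ₂) (Sum.inr ρ) (Sum.inl κ₂))
          - ∑' w, A ((N : ℤ) • w) ((N : ℤ) • y + toSite v) (Sum.inr ρ) (Sum.inl κ₂)) := fun ρ => tsum_coarseWeight_eq_boxSum hA hδ hN y (Sum.inr ρ)
  simp only [eF, eC] at h
  exact h

/-! ## §4 The literal comb letter -/

/-- NOT IN PRINT; OUR BOOKKEEPING.  **THE (γ) CHARGE OF THE LITERAL COMB LETTER AGAINST SLOT-CONSTANT TABLE CHARGES, IN FINITE FORM** (`A_j(ν,y′) = G_j ∘ dM G_j Lc S_j M1_j ν y′`,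
INTENT 4's `exists_vertexFamily_combResponse`): for every level `j`, in-block root, label `y`, slot `(ν,y′)`, channel `(a,b)`, and every bounded `ω` whose table charges
`Z_ω(S_j κ u) = ζS κ`, `Z_ω(M1_j ρ w) = ζM ρ` are SLOT-CONSTANT (displayed), the ω-charge of the (γ) piece is the finite box sum of §3 with the column sums of `A_j(ν,y′)`.  This is the
(γ) half of road-P2 g39's (T-F) «`W^γ_κ(ν,y′) = −W^{α⁺}_κ(ν,y′)`» in closed form; the (α⁺) half is `WardResidualRotatedVertexTotals.totalWeightEnd_eq`; (T-F) itself NOT claimed. -/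
theorem hasSum_comb_gaugeCharge_eq_totals {Lc : ℕ} [NeZero Lc] (hLc : 1 ≤ Lc) {r : Fin (d + 1) → ℕ} (hr : r ∈ box (d + 1) Lc) (cE cVH cΛ : ℝ) (j : ℕ)
    (y : Site (d + 1)) (ν : Fin (d + 1)) (y' : Site (d + 1)) (a b : Fib d) {ω : Site (d + 1) × Site (d + 1) → ℝ} {B : ℝ} (hω : ∀ xz, |ω xz| ≤ B)
    {ζS ζM : Fin (d + 1) → ℝ}
    (hζS : ∀ κ u, ∑' xz : Site (d + 1) × Site (d + 1), ω xz * SpureRecAt d Lc (toSite r) cE cVH cΛ j κ u xz.1 xz.2 a b = ζS κ)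
    (hζM : ∀ ρ w, ∑' xz : Site (d + 1) × Site (d + 1), ω xz * M1At d Lc (toSite r) cΛ j ρ w xz.1 xz.2 a b = ζM ρ) :
    HasSum (fun xz : Site (d + 1) × Site (d + 1) => ω xz *
        (∑ κ, wsum (fun u => ∑' x₂, ∑ κ₂,
              comp (coDressKBmAt (toSite r) Lc (KInvStep (d := d) Lc j))
                (dM (coDressKBmAt (toSite r) Lc (KInvStep (d := d) Lc j)) Lc (SpureRecAt d Lc (toSite r) cE cVH cΛ j) (M1At d Lc (toSite r) cΛ j) ν y')
                u x₂ (Sum.inl κ) (Sum.inl κ₂) * gaugeWt Lc y κ₂ x₂) (SpureRecAt d Lc (toSite r) cE cVH cΛ j κ)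
          + ∑ ρ', cwsum Lc (fun w => ∑' x₂, ∑ κ₂,
              comp (coDressKBmAt (toSite r) Lc (KInvStep (d := d) Lc j))
                (dM (coDressKBmAt (toSite r) Lc (KInvStep (d := d) Lc j)) Lc (SpureRecAt d Lc (toSite r) cE cVH cΛ j) (M1At d Lc (toSite r) cΛ j) ν y')
                ((Lc : ℤ) • w) x₂ (Sum.inr ρ') (Sum.inl κ₂) * gaugeWt Lc y κ₂ x₂) (M1At d Lc (toSite r) cΛ j ρ')) xz.1 xz.2 a b)
      (∑ κ, (∑ v ∈ box (d + 1) Lc, ∑ κ₂,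
            ((∑' u, comp (coDressKBmAt (toSite r) Lc (KInvStep (d := d) Lc j))
                (dM (coDressKBmAt (toSite r) Lc (KInvStep (d := d) Lc j)) Lc (SpureRecAt d Lc (toSite r) cE cVH cΛ j) (M1At d Lc (toSite r) cΛ j) ν y')
                u ((Lc : ℤ) • y + toSite v - unitVec κ₂) (Sum.inl κ) (Sum.inl κ₂))
            - ∑' u, comp (coDressKBmAt (toSite r) Lc (KInvStep (d := d) Lc j))
                (dM (coDressKBmAt (toSite r) Lc (KInvStep (d := d) Lc j)) Lc (SpureRecAt d Lc (toSite r) cE cVH cΛ j) (M1At d Lc (toSite r) cΛ j) ν y')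
                u ((Lc : ℤ) • y + toSite v) (Sum.inl κ) (Sum.inl κ₂))) * ζS κ
        + ∑ ρ', (∑ v ∈ box (d + 1) Lc, ∑ κ₂,
            ((∑' w, comp (coDressKBmAt (toSite r) Lc (KInvStep (d := d) Lc j))
                (dM (coDressKBmAt (toSite r) Lc (KInvStep (d := d) Lc j)) Lc (SpureRecAt d Lc (toSite r) cE cVH cΛ j) (M1At d Lc (toSite r) cΛ j) ν y')
                ((Lc : ℤ) • w) ((Lc : ℤ) • y + toSite v - unitVec κ₂) (Sum.inr ρ') (Sum.inl κ₂))
            - ∑' w, comp (coDressKBmAt (toSite r) Lc (KInvStep (d := d) Lc j))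
                (dM (coDressKBmAt (toSite r) Lc (KInvStep (d := d) Lc j)) Lc (SpureRecAt d Lc (toSite r) cE cVH cΛ j) (M1At d Lc (toSite r) cΛ j) ν y')
                ((Lc : ℤ) • w) ((Lc : ℤ) • y + toSite v) (Sum.inr ρ') (Sum.inl κ₂))) * ζM ρ') := by
  obtain ⟨CA, Cs, CM, δ, hδ, hA, hS, hM⟩ := exists_vertexFamily_combResponse hLc hr cE cVH cΛ j
  exact hasSum_weighted_gaugeSup_eq_totals (hA ν y') hδ hLc y hS hM a b hω hζS hζM

end Summit.QuantumFields.BalabanUV.Beta.GAN24.GaugeReadChargeTotals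

end
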